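import Summits.QuantumFields.BalabanUV.Beta.FP.RelInvPeriodisedOneShot
import Summits.QuantumFields.BalabanUV.Beta.CompositeOneShotChart
import Summits.QuantumFields.BalabanUV.Beta.FP.TowerRootCentred
import Summits.QuantumFields.BalabanUV.Beta.CompositeOneShotJetData

/-!
# `BalabanUV.Beta.FP.RelInvPeriodisedOneShotComp` — road «FP» (binder row D1), ROUTE T row **(T-INV)** AT THE COMPOSITE ONE-SHOT CHART OF RECORD —
# SPEC-49 §B (J-W) (ii) «(T-INV)-comp», TORUS HALF: **leaf-05's one-shot series `RelInvPeriodisedOneShot` §3 WITH ITS FIVE DISPLAYED CHART LETTERS DISCHARGED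
# at an2's composite pair `(A_N, 𝕄_N) = (Ψ̂_{n+1} ∘ coDressKBmAt (bigRoot Lc rs n) (Lc^(n+1)) (KInv (Lc^(n+1))) ∘ Ψ̂_{n+1}ᵀ, bhKcomp r Lc (n+1))`** (`CompositeOneShotChart` §2's
# seven letters BY NAME) — the composite twin of `RelInvPeriodisedCombMinOp` ∕ `RelInvPeriodisedCombRecord` (which instantiate the chart-generic series at the one-step
# comb chart `GcombSh`); and (§2) the same at the CENTRED tower of record in the row's own spelling `A_N = AN (Roots.ctr Lc) n` (`d + 1 = 4`, odd `Lc`)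

WHY (located).  Road FP's RULING R-FP-77 (journal l.67224) leaves TWO junctions for the END wrapper's `hHN₁` (`StepRecursionFeedNestedNamedB` p405971 ✓); the road OWNER's
SPEC-49 §B (`HOME/b2b-balaban-beta-d1-p3/g38/SPEC-49.md`) writes the W junction (J-W) as «torus nested composite minimiser column = periodised lattice one-shot composite
chart column, up to the pins» and names its candidate chain: (i) torus nested = torus one-shot (the road's); **(ii) torus one-shot KKT inverse = `perF T` of the lattice
relative-inverse chart at blocking `Lc^(n+2)` — the COMPOSITE twin of `FP/RelInvPeriodisedComb*`, NEW item «(T-INV)-comp»**; (iii) the scalar pins (the road's).  The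
chart-generic series is leaf-05's `RelInvPeriodisedOneShot` §3 (p336600 ✓): at the ONE-SHOT slice of every depth `n` (finest torus `towerTorus Lc M n`, scale
`bigRatio Lc n = Lc^(n+1)`, root `bigRoot Lc rs n`, rows leaf-06's `bigP Lc M rs hrs n`) it gives, FOR ANY lattice pair `(A, 𝕄)` carrying the five letters `hA hMh hAt hMt hrel`
(+ `hmm hanti`) — DISPLAYED there («an2 names the `(n+1)`-fold composite's chart») — the one-shot (INV)∕`h0`, the fluctuation covariance `Γ = +Â` masked, the `μ`-columns of the
minimiser `I = +Â` masked, the `μ`-rows of the left companion `L = −Â` masked, and the `μμ` corner of the effective form `S₁₁ = Â.submatrix fμ fμ`.  an2 g48 NAMED the chart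
and typed the seven letters in exactly those hypothesis shapes (`CompositeOneShotChart.tower_spr_A ∕ tower_spr_M ∕ tower_shiftK_A ∕ tower_shiftK_M ∕ tower_relInv ∕ tower_mm ∕
tower_anti`, p368149 ✓; consumed for the (S3-1) SOCKETS by the road's `TowerLawFullIndexNamedCharts` p373192 ✓).  THIS FILE puts the two together: the five one-shot identities with NO
chart letter left displayed — what remains displayed is the slot presentation `fμ hfμ hμ hcoarse` (any injective `inr`-valued coarse presentation at scale `bigRatio Lc n`)
and the box divisibility `Lc ∣ M i`.  §2 re-spells the chart at the CENTRED tower of record (R-D1-g49-1 ∕ R-D1-g52-1: `r k = rs k = ctrOff 4 Lc`; leaf-05's F6f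
`TowerRootCentred.bigRoot_ctrOff_pow` (p373975 ✓): the composed big root is `ctr 4 (Lc^(n+1)) = toSite ((Roots.ctr Lc).s (n+1))`) as the row's `AN (Roots.ctr Lc) n`
(`CompositeOneShotJetData.AN_eq`, `compChart` = K-U3d's literal VERBATIM — `rfl`), i.e. in the currency of the wrapper's `hEAN ∕ hAEN ∕ hLN ∕ (J-W)` right sides
`perF T (AN (Roots.ctr Lc) (n+1))` (take this file's `n := n+1`, `M := fine Lc (Mc B)`).

WHAT ([folklore] instantiation BY NAME; no `def`, no `def … : Prop`, nothing cited, 0 sorry): §1 (generic `d`, every `Lc ≥ 1`, every depth `n`, every box `M` with `Lc ∣ M i`,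
every in-block corrector root list `r` and big-root sequence `rs`, any slot presentation): `torus_isUnit_det_kkt_oneShot_comp`, `torus_flucCov_eq_oneShot_comp`,
**`torus_minOp_submatrix_inl_oneShot_comp`**, `torus_minOpL_submatrix_inl_oneShot_comp`, `effForm_toBlocks₁₁_oneShot_comp`; §2 (`d + 1 = 4`, odd `Lc`, the centred tower):
`compositeA_ctr_eq_AN` (the chart letter's literal at the centred roots IS `AN (Roots.ctr Lc) n`), `axEc_bigRoot_ctr` (its mask is `axEc (ctr 4 (Lc^(n+1))) (Lc^(n+1))`),
**`torus_minOp_submatrix_inl_oneShot_AN_ctr`**, `torus_flucCov_eq_oneShot_AN_ctr`, `torus_minOpL_submatrix_inl_oneShot_AN_ctr`, `effForm_toBlocks₁₁_oneShot_AN_ctr`,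
`torus_isUnit_det_kkt_oneShot_ctr`.
WHAT THIS IS NOT: not (J-W) (the junction also needs (i) nested = one-shot and (iii) the pins — the road's), not the lattice half of (ii) (an2's, by name: it IS the seven
letters, already ✓), not the `hH ∕ hQ` identifications of the wrapper's pinned `H₀ ∕ 𝔔₀` with `(perF T 𝕄_N)|ff ∕ (perF T 𝕄_N).submatrix fN ff` (an2 §3
`perF_bhKcomp_submatrix_inl_inl_eq` + the road's unit `S_N`, as in `TowerLawFullIndexNamedCharts` — the consumer's `rw`); no row of the END wrapper discharged; 0 estimates;
nothing of Bałaban's asserted, valued or discharged; 0∕4 row-D1 binders (hW, hR, D1Tel, D1Rep); ROOT M‴ p325680 untouched; NOT (C1), NOT (L2′), NOT (T-ID), NOT SDF,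
NOT D1, NEVER «G-an2-4 closed», NOT BetaPertH, NOT continuum, NOT Clay.

HONEST DEPENDENCY (page 1, mandatory): continuum YM on T⁴ ⇐ BetaPertH ∧ nine spine estimates (0/9 proved); BetaPertH ⇐ (D1) ∧ (D4) ∧ CAP+tail;
G-an2-4 gates asym, D1 and NE2/3/4.  HONEST FRAMING (cell contract, verbatim): «discharging `BetaPertH` makes Bałaban's UV stability UNCONDITIONAL —
a real constructive-QFT result; it is NOT the continuum limit and NOT the Clay problem.»  ABSOLUTE RULE (cell charter, verbatim): «No internally-minted
statement may enter as a cited fact. Every hypothesis is either kernel-proved in this package or a verbatim quotation of a PUBLISHED theorem with page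
reference. The manuscript(s) under audit are NOT citable for their own disputed steps — they are the thing under adjudication; programme-internal
(2001/route/tribunal) claims are never citable.»  D1 formalisation swarm LEAF PROVER 03 (b2b-balaban-beta-d1-formalise-leaf-03 gen 56), 2026-08-27.  No existing file touched.
-/

noncomputable section

open scoped BigOperators Matrix

namespace Summit.QuantumFields.BalabanUV.Beta.FP.RelInvPeriodisedOneShotComp

open Matrix
open Literature.Probability.LatticeModels (Torus.proj)
open Literature.MathematicalPhysics.QuantumFieldTheory.Balaban1983to89
open Literature.MathematicalPhysics.QuantumFieldTheory.Balaban1983to89.Beta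
open Literature.MathematicalPhysics.QuantumFieldTheory.Balaban1983to89.Beta.Composition (kkt)
open Literature.MathematicalPhysics.QuantumFieldTheory.Balaban1983to89.Beta.CompositionSingular (effForm flucCov minOp minOpL)
open B6Lemma24Torus (pbox)
open ExpKernelCalculus (MKer shiftK comp)
open AffineAveraging (Site box toSite)
open AveragingContoursRooted (ctr ctrOff)
open OneStepResolventKernel (Fib KInv)
open Summit.QuantumFields.BalabanUV.Beta.TameKernelCalculus (Spr trK)
open Summit.QuantumFields.BalabanUV.Beta.ChartConjugationRelative (RelInv)
open Summit.QuantumFields.BalabanUV.Beta.AxialDressingRooted (axEc coDressKBmAt)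
open Summit.QuantumFields.BalabanUV.Beta.CompositeCorrectorKernel (psiK)
open Summit.QuantumFields.BalabanUV.Beta.RelInvComposite (bhKcomp)
open Summit.QuantumFields.BalabanUV.Beta.CompositeOneShotChart (tower_spr_A tower_spr_M tower_shiftK_A tower_shiftK_M tower_relInv tower_mm tower_anti)
open Summit.QuantumFields.BalabanUV.Beta.CompositeOneShotJetData (Roots AN)
open Summit.QuantumFields.BalabanUV.Beta.FP.KernelPeriodisationFib (Idx perF)
open Summit.QuantumFields.BalabanUV.Beta.FP.TorusCompositeObjects (towerTorus bigRatio bigRoot bigP bigRatio_eq_pow)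
open Summit.QuantumFields.BalabanUV.Beta.FP.TowerRootCentred (bigRoot_ctrOff_pow)
open Summit.QuantumFields.BalabanUV.Beta.FP.RelInvPeriodisedOneShot (torus_isUnit_det_kkt_oneShot_of_relInv torus_flucCov_eq_oneShot_of_relInv
  torus_minOp_submatrix_inl_oneShot_of_relInv torus_minOpL_submatrix_inl_oneShot_of_relInv effForm_toBlocks₁₁_oneShot_of_relInv)

variable {d : ℕ}

/-! ## §1 The one-shot series at an2's composite chart: the five chart letters discharged (generic `d`, tower spelling) -/

section Letters

variable (Lc : ℕ) [NeZero Lc] {r : ℕ → (Fin (d + 1) → ℕ)} (rs : ℕ → (Fin (d + 1) → ℕ)) (n : ℕ)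

/-- [folklore] `hAt` at the series' scale spelling `bigRatio Lc n` (an2's `tower_shiftK_A` after `bigRatio_eq_pow`). -/
theorem shiftK_compositeA_bigRatio (t : Fin (d + 1) → ℤ) :
    shiftK ((bigRatio Lc n : ℤ) • t)
        (comp (comp (psiK r Lc (n + 1)) (coDressKBmAt (bigRoot Lc rs n) (Lc ^ (n + 1)) (KInv (N := Lc ^ (n + 1)) (d := d)))) (trK (psiK r Lc (n + 1))))
      = comp (comp (psiK r Lc (n + 1)) (coDressKBmAt (bigRoot Lc rs n) (Lc ^ (n + 1)) (KInv (N := Lc ^ (n + 1)) (d := d)))) (trK (psiK r Lc (n + 1))) := by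
  rw [bigRatio_eq_pow]; exact tower_shiftK_A Lc r n rs t

/-- [folklore] `hMt` at the series' scale spelling (an2's `tower_shiftK_M` after `bigRatio_eq_pow`). -/
theorem shiftK_bhKcomp_bigRatio (t : Fin (d + 1) → ℤ) :
    shiftK ((bigRatio Lc n : ℤ) • t) (bhKcomp (d := d) r Lc (n + 1)) = bhKcomp (d := d) r Lc (n + 1) := by
  rw [bigRatio_eq_pow]; exact tower_shiftK_M Lc r n t

/-- [folklore] `hrel` at the series' scale spelling (an2's `tower_relInv` — K-U3d's `relInv_composite` at the big root — after `bigRatio_eq_pow`). -/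
theorem relInv_compositeA_bigRatio (hr : ∀ k, r k ∈ box (d + 1) Lc) (hrs : ∀ k i, 0 ≤ toSite (rs k) i ∧ toSite (rs k) i < (Lc : ℤ)) :
    RelInv (comp (comp (psiK r Lc (n + 1)) (coDressKBmAt (bigRoot Lc rs n) (Lc ^ (n + 1)) (KInv (N := Lc ^ (n + 1)) (d := d)))) (trK (psiK r Lc (n + 1))))
      (bhKcomp (d := d) r Lc (n + 1)) (axEc (bigRoot Lc rs n) (bigRatio Lc n)) := by
  rw [bigRatio_eq_pow]; exact tower_relInv Lc hr n hrs

end Letters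

section Comp

variable (Lc : ℕ) [NeZero Lc] (M : Fin (d + 1) → ℕ) [∀ μ, NeZero (M μ)] (hM : ∀ i, Lc ∣ M i)
  {r : ℕ → (Fin (d + 1) → ℕ)} (hr : ∀ k, r k ∈ box (d + 1) Lc)
  (rs : ℕ → (Fin (d + 1) → ℕ)) (hrs : ∀ k i, 0 ≤ toSite (rs k) i ∧ toSite (rs k) i < (Lc : ℤ)) (n : ℕ)
  {μ : Type*} [Fintype μ] [DecidableEq μ] (fμ : μ → Idx (towerTorus Lc M n) (Fib d)) (hfμ : Function.Injective fμ)
  (hμ : ∀ a : μ, ∃ m : Fin (d + 1), (fμ a).2 = Sum.inr m)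
  (hcoarse : ∀ (s : ↥(pbox (towerTorus Lc M n))) (m : Fin (d + 1)),
    ((s, Sum.inr m) : Idx (towerTorus Lc M n) (Fib d)) ∈ Set.range fμ ↔ Torus.proj (bigRatio Lc n) (s : Site (d + 1)) = 0)
include hM hr hfμ hμ hcoarse

set_option synthInstance.maxSize 1024 in
/-- [folklore] **THE ONE-SHOT (INV) ∕ `h0` AT THE COMPOSITE CHART**: the field block of `perF T 𝕄_N` (`𝕄_N := bhKcomp r Lc (n+1)`, `T := towerTorus Lc M n`) bordered by its rows at
any injective `inr`-valued coarse presentation `fμ` and by leaf-06's one-shot comb rows `bigP Lc M rs hrs n` is non-degenerate — leaf-05's `torus_isUnit_det_kkt_oneShot_of_relInv`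
with the five chart letters supplied by an2's `tower_*`. -/
theorem torus_isUnit_det_kkt_oneShot_comp :
    IsUnit (kkt
      ((perF (towerTorus Lc M n) (bhKcomp (d := d) r Lc (n + 1))).submatrix
        (fun b : ↥(pbox (towerTorus Lc M n)) × Fin (d + 1) => ((b.1, Sum.inl b.2) : Idx (towerTorus Lc M n) (Fib d)))
        (fun b : ↥(pbox (towerTorus Lc M n)) × Fin (d + 1) => ((b.1, Sum.inl b.2) : Idx (towerTorus Lc M n) (Fib d))))
      (fromRows
        ((perF (towerTorus Lc M n) (bhKcomp (d := d) r Lc (n + 1))).submatrix fμ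
          (fun b : ↥(pbox (towerTorus Lc M n)) × Fin (d + 1) => ((b.1, Sum.inl b.2) : Idx (towerTorus Lc M n) (Fib d))))
        (bigP Lc M rs hrs n))).det :=
  torus_isUnit_det_kkt_oneShot_of_relInv Lc M rs hrs n hM (tower_spr_A Lc hr n hrs) (tower_spr_M Lc hr n)
    (shiftK_compositeA_bigRatio Lc rs n) (shiftK_bhKcomp_bigRatio Lc n)
    (relInv_compositeA_bigRatio Lc rs n hr hrs) (tower_mm Lc r n) (tower_anti Lc r n) fμ hfμ hμ hcoarse

set_option synthInstance.maxSize 1024 in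
/-- [folklore] **THE ONE-SHOT Γ AT THE COMPOSITE CHART**: the fluctuation covariance of the one-shot sliced composite system is `+perF T A_N` between non-comb field slots
of the big comb, `0` as soon as one slot is on it (`axEc (bigRoot Lc rs n) (bigRatio Lc n)`-masked),
`A_N := Ψ̂_{n+1} ∘ coDressKBmAt (bigRoot Lc rs n) (Lc^(n+1)) (KInv (Lc^(n+1))) ∘ Ψ̂_{n+1}ᵀ`. -/
theorem torus_flucCov_eq_oneShot_comp :
    flucCov
        ((perF (towerTorus Lc M n) (bhKcomp (d := d) r Lc (n + 1))).submatrix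
          (fun b : ↥(pbox (towerTorus Lc M n)) × Fin (d + 1) => ((b.1, Sum.inl b.2) : Idx (towerTorus Lc M n) (Fib d)))
          (fun b : ↥(pbox (towerTorus Lc M n)) × Fin (d + 1) => ((b.1, Sum.inl b.2) : Idx (towerTorus Lc M n) (Fib d))))
        (fromRows
          ((perF (towerTorus Lc M n) (bhKcomp (d := d) r Lc (n + 1))).submatrix fμ
            (fun b : ↥(pbox (towerTorus Lc M n)) × Fin (d + 1) => ((b.1, Sum.inl b.2) : Idx (towerTorus Lc M n) (Fib d))))
          (bigP Lc M rs hrs n))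
      = Matrix.of fun (b b' : ↥(pbox (towerTorus Lc M n)) × Fin (d + 1)) =>
          axEc (bigRoot Lc rs n) (bigRatio Lc n) (b.1 : Site (d + 1)) (b.1 : Site (d + 1)) (Sum.inl b.2) (Sum.inl b.2)
            * (axEc (bigRoot Lc rs n) (bigRatio Lc n) (b'.1 : Site (d + 1)) (b'.1 : Site (d + 1)) (Sum.inl b'.2) (Sum.inl b'.2)
              * perF (towerTorus Lc M n)
                  (comp (comp (psiK r Lc (n + 1)) (coDressKBmAt (bigRoot Lc rs n) (Lc ^ (n + 1)) (KInv (N := Lc ^ (n + 1)) (d := d))))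
                    (trK (psiK r Lc (n + 1))))
                  (b.1, Sum.inl b.2) (b'.1, Sum.inl b'.2)) :=
  torus_flucCov_eq_oneShot_of_relInv Lc M rs hrs n hM (tower_spr_A Lc hr n hrs) (tower_spr_M Lc hr n)
    (shiftK_compositeA_bigRatio Lc rs n) (shiftK_bhKcomp_bigRatio Lc n)
    (relInv_compositeA_bigRatio Lc rs n hr hrs) (tower_mm Lc r n) (tower_anti Lc r n) fμ hfμ hμ hcoarse

set_option synthInstance.maxSize 1024 in
/-- [folklore] **THE ONE-SHOT I AT THE COMPOSITE CHART — SPEC-49 §B (J-W) (ii), TORUS HALF**: the `μ`-columns of the one-shot minimiser operator of the composite system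
are `+perF T A_N` (field × multiplier), masked on the big comb. -/
theorem torus_minOp_submatrix_inl_oneShot_comp :
    (minOp
        ((perF (towerTorus Lc M n) (bhKcomp (d := d) r Lc (n + 1))).submatrix
          (fun b : ↥(pbox (towerTorus Lc M n)) × Fin (d + 1) => ((b.1, Sum.inl b.2) : Idx (towerTorus Lc M n) (Fib d)))
          (fun b : ↥(pbox (towerTorus Lc M n)) × Fin (d + 1) => ((b.1, Sum.inl b.2) : Idx (towerTorus Lc M n) (Fib d))))
        (fromRows
          ((perF (towerTorus Lc M n) (bhKcomp (d := d) r Lc (n + 1))).submatrix fμ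
            (fun b : ↥(pbox (towerTorus Lc M n)) × Fin (d + 1) => ((b.1, Sum.inl b.2) : Idx (towerTorus Lc M n) (Fib d))))
          (bigP Lc M rs hrs n))).submatrix id Sum.inl
      = Matrix.of fun (b : ↥(pbox (towerTorus Lc M n)) × Fin (d + 1)) (a : μ) =>
          axEc (bigRoot Lc rs n) (bigRatio Lc n) (b.1 : Site (d + 1)) (b.1 : Site (d + 1)) (Sum.inl b.2) (Sum.inl b.2)
            * perF (towerTorus Lc M n)
                (comp (comp (psiK r Lc (n + 1)) (coDressKBmAt (bigRoot Lc rs n) (Lc ^ (n + 1)) (KInv (N := Lc ^ (n + 1)) (d := d))))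
                  (trK (psiK r Lc (n + 1))))
                (b.1, Sum.inl b.2) (fμ a) :=
  torus_minOp_submatrix_inl_oneShot_of_relInv Lc M rs hrs n hM (tower_spr_A Lc hr n hrs) (tower_spr_M Lc hr n)
    (shiftK_compositeA_bigRatio Lc rs n) (shiftK_bhKcomp_bigRatio Lc n)
    (relInv_compositeA_bigRatio Lc rs n hr hrs) (tower_mm Lc r n) (tower_anti Lc r n) fμ hfμ hμ hcoarse

set_option synthInstance.maxSize 1024 in
/-- [folklore] **THE ONE-SHOT L AT THE COMPOSITE CHART**: the `μ`-rows of the one-shot left companion are `−perF T A_N` (multiplier × field), masked on the big comb. -/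
theorem torus_minOpL_submatrix_inl_oneShot_comp :
    (minOpL
        ((perF (towerTorus Lc M n) (bhKcomp (d := d) r Lc (n + 1))).submatrix
          (fun b : ↥(pbox (towerTorus Lc M n)) × Fin (d + 1) => ((b.1, Sum.inl b.2) : Idx (towerTorus Lc M n) (Fib d)))
          (fun b : ↥(pbox (towerTorus Lc M n)) × Fin (d + 1) => ((b.1, Sum.inl b.2) : Idx (towerTorus Lc M n) (Fib d))))
        (fromRows
          ((perF (towerTorus Lc M n) (bhKcomp (d := d) r Lc (n + 1))).submatrix fμ
            (fun b : ↥(pbox (towerTorus Lc M n)) × Fin (d + 1) => ((b.1, Sum.inl b.2) : Idx (towerTorus Lc M n) (Fib d))))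
          (bigP Lc M rs hrs n))).submatrix Sum.inl id
      = -Matrix.of fun (a : μ) (b : ↥(pbox (towerTorus Lc M n)) × Fin (d + 1)) =>
          axEc (bigRoot Lc rs n) (bigRatio Lc n) (b.1 : Site (d + 1)) (b.1 : Site (d + 1)) (Sum.inl b.2) (Sum.inl b.2)
            * perF (towerTorus Lc M n)
                (comp (comp (psiK r Lc (n + 1)) (coDressKBmAt (bigRoot Lc rs n) (Lc ^ (n + 1)) (KInv (N := Lc ^ (n + 1)) (d := d))))
                  (trK (psiK r Lc (n + 1))))
                (fμ a) (b.1, Sum.inl b.2) :=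
  torus_minOpL_submatrix_inl_oneShot_of_relInv Lc M rs hrs n hM (tower_spr_A Lc hr n hrs) (tower_spr_M Lc hr n)
    (shiftK_compositeA_bigRatio Lc rs n) (shiftK_bhKcomp_bigRatio Lc n)
    (relInv_compositeA_bigRatio Lc rs n hr hrs) (tower_mm Lc r n) (tower_anti Lc r n) fμ hfμ hμ hcoarse

set_option synthInstance.maxSize 1024 in
/-- [folklore] **THE ONE-SHOT S₁₁ AT THE COMPOSITE CHART**: the `μμ` corner of the one-shot effective form is the `μ`-block of `perF T A_N` (no mask). -/
theorem effForm_toBlocks₁₁_oneShot_comp :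
    (effForm
        ((perF (towerTorus Lc M n) (bhKcomp (d := d) r Lc (n + 1))).submatrix
          (fun b : ↥(pbox (towerTorus Lc M n)) × Fin (d + 1) => ((b.1, Sum.inl b.2) : Idx (towerTorus Lc M n) (Fib d)))
          (fun b : ↥(pbox (towerTorus Lc M n)) × Fin (d + 1) => ((b.1, Sum.inl b.2) : Idx (towerTorus Lc M n) (Fib d))))
        (fromRows
          ((perF (towerTorus Lc M n) (bhKcomp (d := d) r Lc (n + 1))).submatrix fμ
            (fun b : ↥(pbox (towerTorus Lc M n)) × Fin (d + 1) => ((b.1, Sum.inl b.2) : Idx (towerTorus Lc M n) (Fib d))))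
          (bigP Lc M rs hrs n))).toBlocks₁₁
      = (perF (towerTorus Lc M n)
          (comp (comp (psiK r Lc (n + 1)) (coDressKBmAt (bigRoot Lc rs n) (Lc ^ (n + 1)) (KInv (N := Lc ^ (n + 1)) (d := d))))
            (trK (psiK r Lc (n + 1))))).submatrix fμ fμ :=
  effForm_toBlocks₁₁_oneShot_of_relInv Lc M rs hrs n hM (tower_spr_A Lc hr n hrs) (tower_spr_M Lc hr n)
    (shiftK_compositeA_bigRatio Lc rs n) (shiftK_bhKcomp_bigRatio Lc n)
    (relInv_compositeA_bigRatio Lc rs n hr hrs) (tower_mm Lc r n) (tower_anti Lc r n) fμ hfμ hμ hcoarse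

end Comp


/-! ## §2 The centred tower of record (`d + 1 = 4`, odd `Lc`): the chart IS the row's `AN (Roots.ctr Lc) n`, the mask is `axEc (ctr 4 (Lc^(n+1))) (Lc^(n+1))` -/

section Centred

variable (Lc : ℕ) [NeZero Lc] (hLc : Odd Lc) (n : ℕ)
include hLc

/-- [folklore] **THE COMPOSITE CHART LETTER AT THE CENTRED ROOTS IS `AN (Roots.ctr Lc) n`**: with corrector roots and big-root sequence both the centred offset
`ctrOff 4 Lc` at every level, an2's tower-spelling literal `Ψ̂_{n+1} ∘ coDressKBmAt (bigRoot Lc rs n) (Lc^(n+1)) KInv ∘ Ψ̂_{n+1}ᵀ` is the row's N chart at door index `n`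
(leaf-05's F6f `bigRoot_ctrOff_pow`: `bigRoot = ctr 4 (Lc^(n+1)) = toSite ((Roots.ctr Lc).s (n+1))`; `AN_eq` + `compChart` = K-U3d's literal, `rfl`). -/
theorem compositeA_ctr_eq_AN :
    comp (comp (psiK (fun _ : ℕ => ctrOff (3 + 1) Lc) Lc (n + 1))
        (coDressKBmAt (bigRoot Lc (fun _ : ℕ => ctrOff (3 + 1) Lc) n) (Lc ^ (n + 1)) (KInv (N := Lc ^ (n + 1)) (d := 3))))
        (trK (psiK (fun _ : ℕ => ctrOff (3 + 1) Lc) Lc (n + 1)))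
      = AN (Roots.ctr Lc) n := by
  rw [bigRoot_ctrOff_pow hLc n]
  rfl

omit [NeZero Lc] in
/-- [folklore] the centred big root's live indicator is `axEc (ctr 4 (Lc^(n+1))) (Lc^(n+1))` (F6f + `bigRatio_eq_pow`). -/
theorem axEc_bigRoot_ctr :
    axEc (d := 3) (bigRoot Lc (fun _ : ℕ => ctrOff (3 + 1) Lc) n) (bigRatio Lc n) = axEc (ctr (3 + 1) (Lc ^ (n + 1))) (Lc ^ (n + 1)) := by
  rw [bigRoot_ctrOff_pow hLc n, bigRatio_eq_pow]

omit hLc in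
/-- [folklore] the centred offset is an in-block root, in the series' range spelling. -/
theorem toSite_ctrOff_range (k : ℕ) (i : Fin (3 + 1)) :
    0 ≤ toSite ((fun _ : ℕ => ctrOff (3 + 1) Lc) k) i ∧ toSite ((fun _ : ℕ => ctrOff (3 + 1) Lc) k) i < (Lc : ℤ) := by
  have hL : 0 < Lc := Nat.pos_of_ne_zero (NeZero.ne Lc)
  have h : (Lc - 1) / 2 < Lc := by omega
  simp only [toSite, ctrOff]
  exact ⟨by positivity, by exact_mod_cast h⟩

omit hLc in
/-- [folklore] the centred offset is an in-block root, in the box spelling. -/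
theorem ctrOff_mem_box_const (k : ℕ) : (fun _ : ℕ => ctrOff (3 + 1) Lc) k ∈ box (3 + 1) Lc :=
  AveragingContoursRooted.ctrOff_mem_box (Nat.one_le_iff_ne_zero.mpr (NeZero.ne Lc))

variable (M : Fin (3 + 1) → ℕ) [∀ μ, NeZero (M μ)] (hM : ∀ i, Lc ∣ M i)
  {μ : Type*} [Fintype μ] [DecidableEq μ] (fμ : μ → Idx (towerTorus Lc M n) (Fib 3)) (hfμ : Function.Injective fμ)
  (hμ : ∀ a : μ, ∃ m : Fin (3 + 1), (fμ a).2 = Sum.inr m)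
  (hcoarse : ∀ (s : ↥(pbox (towerTorus Lc M n))) (m : Fin (3 + 1)),
    ((s, Sum.inr m) : Idx (towerTorus Lc M n) (Fib 3)) ∈ Set.range fμ ↔ Torus.proj (bigRatio Lc n) (s : Site (3 + 1)) = 0)
include hM hfμ hμ hcoarse

omit hLc in
set_option synthInstance.maxSize 1024 in
/-- [folklore] **THE ONE-SHOT (INV) ∕ `h0` AT THE CENTRED COMPOSITE TOWER** (`𝕄_N := bhKcomp (fun _ => ctrOff 4 Lc) Lc (n+1)`, rows `bigP` at the centred root sequence). -/
theorem torus_isUnit_det_kkt_oneShot_ctr :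
    IsUnit (kkt
      ((perF (towerTorus Lc M n) (bhKcomp (d := 3) (fun _ : ℕ => ctrOff (3 + 1) Lc) Lc (n + 1))).submatrix
        (fun b : ↥(pbox (towerTorus Lc M n)) × Fin (3 + 1) => ((b.1, Sum.inl b.2) : Idx (towerTorus Lc M n) (Fib 3)))
        (fun b : ↥(pbox (towerTorus Lc M n)) × Fin (3 + 1) => ((b.1, Sum.inl b.2) : Idx (towerTorus Lc M n) (Fib 3))))
      (fromRows
        ((perF (towerTorus Lc M n) (bhKcomp (d := 3) (fun _ : ℕ => ctrOff (3 + 1) Lc) Lc (n + 1))).submatrix fμ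
          (fun b : ↥(pbox (towerTorus Lc M n)) × Fin (3 + 1) => ((b.1, Sum.inl b.2) : Idx (towerTorus Lc M n) (Fib 3))))
        (bigP Lc M (fun _ : ℕ => ctrOff (3 + 1) Lc) (toSite_ctrOff_range Lc) n))).det :=
  torus_isUnit_det_kkt_oneShot_comp Lc M hM (ctrOff_mem_box_const Lc) (fun _ : ℕ => ctrOff (3 + 1) Lc) (toSite_ctrOff_range Lc) n fμ hfμ hμ hcoarse

set_option synthInstance.maxSize 1024 in
/-- [folklore] **THE ONE-SHOT I AT THE CENTRED COMPOSITE TOWER, IN THE ROW's CURRENCY — SPEC-49 §B (J-W) (ii), TORUS HALF**: the `μ`-columns of the one-shot minimiser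
operator of the centred composite system of depth `n+1` on `T := towerTorus Lc M n` are `+perF T (AN (Roots.ctr Lc) n)` (field × multiplier), masked by
`axEc (ctr 4 (Lc^(n+1))) (Lc^(n+1))` on the field slot (for the END wrapper's storey `n′`: `n := n′+1`, `M := fine Lc (Mc B)`, chart `AN (Roots.ctr Lc) (n′+1)`). -/
theorem torus_minOp_submatrix_inl_oneShot_AN_ctr :
    (minOp
        ((perF (towerTorus Lc M n) (bhKcomp (d := 3) (fun _ : ℕ => ctrOff (3 + 1) Lc) Lc (n + 1))).submatrix
          (fun b : ↥(pbox (towerTorus Lc M n)) × Fin (3 + 1) => ((b.1, Sum.inl b.2) : Idx (towerTorus Lc M n) (Fib 3)))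
          (fun b : ↥(pbox (towerTorus Lc M n)) × Fin (3 + 1) => ((b.1, Sum.inl b.2) : Idx (towerTorus Lc M n) (Fib 3))))
        (fromRows
          ((perF (towerTorus Lc M n) (bhKcomp (d := 3) (fun _ : ℕ => ctrOff (3 + 1) Lc) Lc (n + 1))).submatrix fμ
            (fun b : ↥(pbox (towerTorus Lc M n)) × Fin (3 + 1) => ((b.1, Sum.inl b.2) : Idx (towerTorus Lc M n) (Fib 3))))
          (bigP Lc M (fun _ : ℕ => ctrOff (3 + 1) Lc) (toSite_ctrOff_range Lc) n))).submatrix id Sum.inl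
      = Matrix.of fun (b : ↥(pbox (towerTorus Lc M n)) × Fin (3 + 1)) (a : μ) =>
          axEc (ctr (3 + 1) (Lc ^ (n + 1))) (Lc ^ (n + 1)) (b.1 : Site (3 + 1)) (b.1 : Site (3 + 1)) (Sum.inl b.2) (Sum.inl b.2)
            * perF (towerTorus Lc M n) (AN (Roots.ctr Lc) n) (b.1, Sum.inl b.2) (fμ a) := by
  rw [← compositeA_ctr_eq_AN Lc hLc n, ← axEc_bigRoot_ctr Lc hLc n]
  exact torus_minOp_submatrix_inl_oneShot_comp Lc M hM (ctrOff_mem_box_const Lc) (fun _ : ℕ => ctrOff (3 + 1) Lc) (toSite_ctrOff_range Lc) n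
    fμ hfμ hμ hcoarse

set_option synthInstance.maxSize 1024 in
/-- [folklore] **THE ONE-SHOT Γ AT THE CENTRED COMPOSITE TOWER, IN THE ROW's CURRENCY**: `+perF T (AN (Roots.ctr Lc) n)` between non-comb field slots, masked by
`axEc (ctr 4 (Lc^(n+1))) (Lc^(n+1))` on both. -/
theorem torus_flucCov_eq_oneShot_AN_ctr :
    flucCov
        ((perF (towerTorus Lc M n) (bhKcomp (d := 3) (fun _ : ℕ => ctrOff (3 + 1) Lc) Lc (n + 1))).submatrix
          (fun b : ↥(pbox (towerTorus Lc M n)) × Fin (3 + 1) => ((b.1, Sum.inl b.2) : Idx (towerTorus Lc M n) (Fib 3)))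
          (fun b : ↥(pbox (towerTorus Lc M n)) × Fin (3 + 1) => ((b.1, Sum.inl b.2) : Idx (towerTorus Lc M n) (Fib 3))))
        (fromRows
          ((perF (towerTorus Lc M n) (bhKcomp (d := 3) (fun _ : ℕ => ctrOff (3 + 1) Lc) Lc (n + 1))).submatrix fμ
            (fun b : ↥(pbox (towerTorus Lc M n)) × Fin (3 + 1) => ((b.1, Sum.inl b.2) : Idx (towerTorus Lc M n) (Fib 3))))
          (bigP Lc M (fun _ : ℕ => ctrOff (3 + 1) Lc) (toSite_ctrOff_range Lc) n))
      = Matrix.of fun (b b' : ↥(pbox (towerTorus Lc M n)) × Fin (3 + 1)) =>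
          axEc (ctr (3 + 1) (Lc ^ (n + 1))) (Lc ^ (n + 1)) (b.1 : Site (3 + 1)) (b.1 : Site (3 + 1)) (Sum.inl b.2) (Sum.inl b.2)
            * (axEc (ctr (3 + 1) (Lc ^ (n + 1))) (Lc ^ (n + 1)) (b'.1 : Site (3 + 1)) (b'.1 : Site (3 + 1)) (Sum.inl b'.2) (Sum.inl b'.2)
              * perF (towerTorus Lc M n) (AN (Roots.ctr Lc) n) (b.1, Sum.inl b.2) (b'.1, Sum.inl b'.2)) := by
  rw [← compositeA_ctr_eq_AN Lc hLc n, ← axEc_bigRoot_ctr Lc hLc n]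
  exact torus_flucCov_eq_oneShot_comp Lc M hM (ctrOff_mem_box_const Lc) (fun _ : ℕ => ctrOff (3 + 1) Lc) (toSite_ctrOff_range Lc) n fμ hfμ hμ hcoarse

set_option synthInstance.maxSize 1024 in
/-- [folklore] **THE ONE-SHOT L AT THE CENTRED COMPOSITE TOWER, IN THE ROW's CURRENCY**: `−perF T (AN (Roots.ctr Lc) n)` (multiplier × field), masked on the field slot. -/
theorem torus_minOpL_submatrix_inl_oneShot_AN_ctr :
    (minOpL
        ((perF (towerTorus Lc M n) (bhKcomp (d := 3) (fun _ : ℕ => ctrOff (3 + 1) Lc) Lc (n + 1))).submatrix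
          (fun b : ↥(pbox (towerTorus Lc M n)) × Fin (3 + 1) => ((b.1, Sum.inl b.2) : Idx (towerTorus Lc M n) (Fib 3)))
          (fun b : ↥(pbox (towerTorus Lc M n)) × Fin (3 + 1) => ((b.1, Sum.inl b.2) : Idx (towerTorus Lc M n) (Fib 3))))
        (fromRows
          ((perF (towerTorus Lc M n) (bhKcomp (d := 3) (fun _ : ℕ => ctrOff (3 + 1) Lc) Lc (n + 1))).submatrix fμ
            (fun b : ↥(pbox (towerTorus Lc M n)) × Fin (3 + 1) => ((b.1, Sum.inl b.2) : Idx (towerTorus Lc M n) (Fib 3))))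
          (bigP Lc M (fun _ : ℕ => ctrOff (3 + 1) Lc) (toSite_ctrOff_range Lc) n))).submatrix Sum.inl id
      = -Matrix.of fun (a : μ) (b : ↥(pbox (towerTorus Lc M n)) × Fin (3 + 1)) =>
          axEc (ctr (3 + 1) (Lc ^ (n + 1))) (Lc ^ (n + 1)) (b.1 : Site (3 + 1)) (b.1 : Site (3 + 1)) (Sum.inl b.2) (Sum.inl b.2)
            * perF (towerTorus Lc M n) (AN (Roots.ctr Lc) n) (fμ a) (b.1, Sum.inl b.2) := by
  rw [← compositeA_ctr_eq_AN Lc hLc n, ← axEc_bigRoot_ctr Lc hLc n]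
  exact torus_minOpL_submatrix_inl_oneShot_comp Lc M hM (ctrOff_mem_box_const Lc) (fun _ : ℕ => ctrOff (3 + 1) Lc) (toSite_ctrOff_range Lc) n
    fμ hfμ hμ hcoarse

set_option synthInstance.maxSize 1024 in
/-- [folklore] **THE ONE-SHOT S₁₁ AT THE CENTRED COMPOSITE TOWER, IN THE ROW's CURRENCY**: the `μμ` corner of the effective form is `(perF T (AN (Roots.ctr Lc) n)).submatrix fμ fμ`. -/
theorem effForm_toBlocks₁₁_oneShot_AN_ctr :
    (effForm
        ((perF (towerTorus Lc M n) (bhKcomp (d := 3) (fun _ : ℕ => ctrOff (3 + 1) Lc) Lc (n + 1))).submatrix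
          (fun b : ↥(pbox (towerTorus Lc M n)) × Fin (3 + 1) => ((b.1, Sum.inl b.2) : Idx (towerTorus Lc M n) (Fib 3)))
          (fun b : ↥(pbox (towerTorus Lc M n)) × Fin (3 + 1) => ((b.1, Sum.inl b.2) : Idx (towerTorus Lc M n) (Fib 3))))
        (fromRows
          ((perF (towerTorus Lc M n) (bhKcomp (d := 3) (fun _ : ℕ => ctrOff (3 + 1) Lc) Lc (n + 1))).submatrix fμ
            (fun b : ↥(pbox (towerTorus Lc M n)) × Fin (3 + 1) => ((b.1, Sum.inl b.2) : Idx (towerTorus Lc M n) (Fib 3))))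
          (bigP Lc M (fun _ : ℕ => ctrOff (3 + 1) Lc) (toSite_ctrOff_range Lc) n))).toBlocks₁₁
      = (perF (towerTorus Lc M n) (AN (Roots.ctr Lc) n)).submatrix fμ fμ := by
  rw [← compositeA_ctr_eq_AN Lc hLc n]
  exact effForm_toBlocks₁₁_oneShot_comp Lc M hM (ctrOff_mem_box_const Lc) (fun _ : ℕ => ctrOff (3 + 1) Lc) (toSite_ctrOff_range Lc) n fμ hfμ hμ hcoarse

end Centred

end Summit.QuantumFields.BalabanUV.Beta.FP.RelInvPeriodisedOneShotComp

end
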